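import Summits.CriticalPhenomena.CardyFormulaZ2.Theses.CardyRotToConf
import Literature.Probability.RandomPlanarGeometry.StarShiftThinHull
import HarnessLib

/-!
# Stub `stub_starShiftThinHull` of line `germ-label-transport` (crux `stmt-CriticalPhenomena-0698`)

Brick (b2) of `stub_isLocal` (LSW locality of SLE₆, restriction form; the image driving function
`W̃_t = W_t + L_A − L_{B_t}` of Lawler–Schramm–Werner (2003) §5): thin `*`-hulls have a small
hydrodynamic constant `L_Q = starShift Q` — for `0 < c ≤ M` and `ε > 0` there is `θ > 0` with
`‖L_Q‖ ≤ ε` for every `*`-hull `Q ⊆ {c ≤ |Re w| ≤ M, Im w ≤ θ}`. The registered stub signature,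
an instance of the Literature theorem `exists_forall_abs_starShift_le_of_thin`
(`StarShiftThinHull.lean`: maximum modulus for `exp(-i(Φ_Q⁻¹ - id))`, Borel–Carathéodory at `∞`
and chained along `{|Re z| < c} ∪ {Im z > 1}`).
-/

noncomputable section

open Literature.Probability.RandomPlanarGeometry

namespace Summit.CriticalPhenomena.CardyFormulaZ2.Theorems.CardyRotToConfR2SymmetryUpgrade

/-- **(b2).** Thin `*`-hulls have small `L`: for `0 < c ≤ M`, `ε > 0` there is `θ > 0` such that
every `*`-hull `Q ⊆ {c ≤ |Re w| ≤ M, Im w ≤ θ}` has `‖starShift Q‖ ≤ ε`.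
[cite: LawlerSchrammWerner2003Restriction, §5] -/
theorem stub_starShiftThinHull : ∀ {c M : ℝ}, 0 < c → c ≤ M → ∀ {ε : ℝ}, 0 < ε →
    ∃ θ : ℝ, 0 < θ ∧ ∀ Q : Set ℂ, IsStarHull Q →
      Q ⊆ {w : ℂ | c ≤ |w.re| ∧ |w.re| ≤ M ∧ w.im ≤ θ} → ‖starShift Q‖ ≤ ε :=
  fun hc hcM _ hε ↦ exists_forall_abs_starShift_le_of_thin hc hcM hε

end Summit.CriticalPhenomena.CardyFormulaZ2.Theorems.CardyRotToConfR2SymmetryUpgrade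

end
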